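import Literature.NumberTheory.Automorphic.UnitaryGroupAutomorphicRep
import Mathlib.Analysis.Complex.Basic
import Mathlib.Topology.Instances.Matrix
import HarnessLib

/-!
# Deligne's axioms for the unitary Shimura datum `(GU(W_{φ₀}), h_{G^ℚ,φ₀})` on real points: the Hodge cocharacter
# `μ_h(t) = diag(t, 1, …, 1)` has weights `1, 0, −1` on `𝔤𝔩_n`, `Int h(√−1) = Int J_{φ₀}`, and its centraliser
# `K_∞ = U(1) × U(n−1)` is compact (Kottwitz 1992 Lemma 4.1; Rapoport–Smithling–Zhang 2017 §3.1, Remark 3.2)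

Topic `NumberTheory/Automorphic`, namespace `Literature.NumberTheory.Automorphic.UnitaryShimuraDatum` (lane
`lit-hodgefound`, Track 2 foundations; seat `lit-hodgefound-p11`, generation 31, row g31-#4).  THEOREMS ONLY (D-0026):
no definition, no named fact, no instance, no notation.  Third file of the g31 series on RSZ's archimedean datum
(`UnitaryShimuraHomomorphisms`: `h_{G^ℚ,φ₀}(z) = diag(z, z̄, …, z̄)`, `h(√−1) = √−1 J_{φ₀}`; `UnitaryShimuraDatumPeriodDomain`:
`√−1 J_{φ₀} ∈ X⁺`; neither is imported — the matrices enter by their formulas `hμ`, `hh`, `hJ`).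

## The print, verbatim

R. E. Kottwitz [Kottwitz1992] §4, Lemma 4.1 p. 386 (held text `paper:doi-10-2307-2152772` p0014 L5–L33): «Lemma 4.1. The pair
`(G, h)` satisfies the following three conditions. (1) The image under `h` of `ℝ^×` is central in `G`. (2) Define
`μ_h : 𝔾_m → G_ℂ` by restricting `h_ℂ : (R_{ℂ/ℝ}𝔾_m)_ℂ → G_ℂ` to the factor of `(R_{ℂ/ℝ}𝔾_m)_ℂ = 𝔾_m × 𝔾_m` indexed by the
identity map from `ℂ` to `ℂ` […]. Then `𝔾_m`, acting on the Lie algebra `Lie(G_ℂ)` by means of `μ_h` and the adjoint action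
of `G_ℂ` on `Lie(G_ℂ)`, has weights `1, 0, −1`. (3) The `ℝ`-form of `G₁` obtained by twisting `G₁` by the inner automorphism
`Int(h(i))` is the compact form of `G₁`. […] (2) follows from the following easily verified fact: Let `V` be a
finite-dimensional complex vector space, let `h : ℂ^× → GL_ℝ(V)` be the restriction of `ℂ → End_ℝ(V)` to `ℂ^×`, and let
`μ_h : 𝔾_m → GL_ℂ(V_ℂ)` be obtained from `h` as before. Then `𝔾_m`, acting on the Lie algebra of `GL_ℂ(V_ℂ)` by means of
`μ_h` and the adjoint action, has weights `1, 0, −1`. To prove (3) we must show that the group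
`{x ∈ C ⊗ ℝ | x x* = 1 and h(i)⁻¹ x h(i) = x}` is compact.»  «Lemma 4.1 says that `(G, h)` satisfies the conditions
(1.5.1), (1.5.2), (1.5.3) of [D3]» (= Deligne 1979 (2.1.1.1)–(2.1.1.3)).

M. Rapoport, B. Smithling, W. Zhang [RapoportSmithlingZhang2017] §3.1 and Remark 3.2 (held `paper:arxiv-1710.06962`
p0009–p0010): «`J_{φ₀} = diag(1, (−1)^{(n−1)})` […] `h_{G^ℚ,φ₀}` induced by `√−1 ↦ √−1 J_{φ₀}` […] `h_{G,φ₀}` is the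
cocharacter `z ↦ diag(z/z̄, 1, …, 1)` […] `Sh_K(G̃, {h_{G̃}})(ℂ) = G̃(ℚ)\[𝒟_{φ₀} × G̃(𝔸_f)/K]`».

## What is formalised (index type `m`, distinguished `i₀`; `μ(t) = diag(t at i₀, 1 elsewhere)` by `hμ`;
## `J = diag(1 at i₀, −1 elsewhere)` by `hJ`; `h(z) = diag(z at i₀, z̄ elsewhere)` by `hh`)

* §1 THE COCHARACTER `μ_h`: `h_eq_mu_mul` (`h(z) = μ(z) · μ'(z̄)` with `μ'(w) = diag(1, w, …, w)` — the two factors of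
  `(R_{ℂ/ℝ}𝔾_m)_ℂ = 𝔾_m × 𝔾_m`, `μ = μ_h` the one «indexed by the identity map»), `mu_mul_mu` (`μ` multiplicative), `mu_one`,
  `mu_mul_mu_inv` (`μ(t) μ(t⁻¹) = 1`), `mu_conj_apply` (the adjoint action in coordinates:
  `(μ(t) X μ(t⁻¹))ᵢⱼ = t^{[i = i₀]} Xᵢⱼ t^{−[j = i₀]}`).
* §2 WEIGHTS `1, 0, −1` (Kottwitz 4.1 (2) = Deligne (2.1.1.1) for `GL_n ⊇ GU(W_{φ₀})`): **`mu_conj_eq_smul_of_row`** (matrices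
  supported on the row `i₀` off the diagonal have weight `1`: `μ(t) X μ(t)⁻¹ = t X`), **`mu_conj_eq_inv_smul_of_col`**
  (column `i₀` off the diagonal: weight `−1`), **`mu_conj_eq_self_of_block`** (block-diagonal matrices: weight `0`), and
  **`exists_weight_decomposition`** (every `X ∈ M_n(ℂ)` is `X₁ + X₀ + X₋₁` with pieces of these three shapes — so the weights
  of `Ad ∘ μ_h` on `𝔤𝔩_n(ℂ) = Lie(GL_ℂ(V_ℂ))`, hence on `Lie(G_ℂ) ⊆ 𝔤𝔩_n`, lie in `{1, 0, −1}`).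
* §3 `Int(h(√−1)) = Int(J_{φ₀})` (Kottwitz 4.1 (3) / Deligne (2.1.1.2) set-up): `h_I_eq_I_smul_J` (`h(√−1) = √−1 J`),
  **`h_I_conj_eq_J_conj`** (`h(√−1) X h(√−1)⁻¹ = J X J`: the scalar `√−1` is central — Kottwitz 4.1 (1) in this instance), **`J_conj_eq_self_iff`** (the fixed points of `Int J` in `M_n(ℂ)` = the CENTRALISER of `h(√−1)` =
  the block-diagonal matrices `Xᵢ₀ⱼ = 0 = Xⱼᵢ₀`, `j ≠ i₀` — the weight-`0` space of §2).
* §4 `K_∞`, THE CENTRALISER OF `h` IN `U(W_{φ₀})(ℝ)` («`{x : x x* = 1, h(i)⁻¹ x h(i) = x}`»): **`kInfty_iff`** (a unitary `g`,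
  `ᵗḡ J g = J`, commuting with `J` is block diagonal with `|g_{i₀i₀}|² = 1` and `ᵗB̄ B = 1` for the complementary block `B` —
  `K_∞ = U(1) × U(n−1)`), **`normSq_apply_le_one_of_kInfty`** (every entry of such `g` has `|gᵢⱼ|² ≤ 1` — `K_∞` is BOUNDED;
  contrast: `U(1, n−1)(ℝ)` itself is unbounded), **`isCompact_kInfty`** (`K_∞` is COMPACT: closed and inside the product of
  unit discs — Kottwitz 4.1 (3) for this datum; `X = G(ℝ)/K_∞` of Remark 3.2).

Not formalised: (2.1.1.3) (no `ℚ`-simple factor of `G^{ad}` with compact real points — a global statement), the Cartan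
involution as an involution of the real algebraic group, maximality of `K_∞`.

## References

* [Kottwitz1992] R. E. Kottwitz, *Points on some Shimura varieties over finite fields*, J. Amer. Math. Soc. 5 (1992), §4
  Lemma 4.1 (p. 386).
* [RapoportSmithlingZhang2017] M. Rapoport, B. Smithling, W. Zhang, *Arithmetic diagonal cycles on unitary Shimura
  varieties*, Compositio Math. 156 (2020) = arXiv 1710.06962, §3.1, Remark 3.2.
* [Deligne1979ShimuraVarieties] P. Deligne, *Variétés de Shimura*, Proc. Symp. Pure Math. 33.2 (1979), (2.1.1.1)–(2.1.1.3).
-/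

open scoped Matrix ComplexConjugate

namespace Literature.NumberTheory.Automorphic.UnitaryShimuraDatum

open Complex Matrix

variable {m : Type*} [Fintype m] [DecidableEq m] (i₀ : m)

/-! ## §1 The Hodge cocharacter `μ_h(t) = diag(t, 1, …, 1)` -/

/-- **`h(z) = μ(z) · μ'(z̄)`**: `diag(z, z̄, …, z̄) = diag(z, 1, …, 1) · diag(1, z̄, …, z̄)` — the decomposition of `h_ℂ` along
`(R_{ℂ/ℝ}𝔾_m)_ℂ = 𝔾_m × 𝔾_m`; `μ = μ_h` is the factor «indexed by the identity map from `ℂ` to `ℂ`».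
[cite: Kottwitz1992, §4 Lemma 4.1 (2)] [cite: RapoportSmithlingZhang2017, Remark 3.2] -/
theorem h_eq_mu_mul {μ h : ℂ → Matrix m m ℂ} (hμ : ∀ t, μ t = Matrix.diagonal fun i => if i = i₀ then t else 1)
    (hh : ∀ z, h z = Matrix.diagonal fun i => if i = i₀ then z else conj z) (z : ℂ) :
    h z = μ z * Matrix.diagonal fun i => if i = i₀ then (1 : ℂ) else conj z := by
  rw [hh, hμ, Matrix.diagonal_mul_diagonal]
  congr 1; funext i
  split_ifs <;> simp

omit [Fintype m] in
/-- `μ(1) = 1`. [cite: Kottwitz1992, §4 Lemma 4.1 (2)] -/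
theorem mu_one [Fintype m] {μ : ℂ → Matrix m m ℂ} (hμ : ∀ t, μ t = Matrix.diagonal fun i => if i = i₀ then t else 1) :
    μ 1 = 1 := by
  rw [hμ, ← Matrix.diagonal_one]
  congr 1; funext i
  split_ifs <;> rfl

/-- `μ` is multiplicative: `μ(s t) = μ(s) μ(t)` (a cocharacter `𝔾_m → GL_n` on points). [cite: Kottwitz1992, §4 Lemma 4.1 (2)] -/
theorem mu_mul_mu {μ : ℂ → Matrix m m ℂ} (hμ : ∀ t, μ t = Matrix.diagonal fun i => if i = i₀ then t else 1) (s t : ℂ) :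
    μ s * μ t = μ (s * t) := by
  rw [hμ, hμ, hμ, Matrix.diagonal_mul_diagonal]
  congr 1; funext i
  split_ifs <;> simp

/-- `μ(t) μ(t⁻¹) = 1` for `t ≠ 0`. [cite: Kottwitz1992, §4 Lemma 4.1 (2)] -/
theorem mu_mul_mu_inv {μ : ℂ → Matrix m m ℂ} (hμ : ∀ t, μ t = Matrix.diagonal fun i => if i = i₀ then t else 1)
    {t : ℂ} (ht : t ≠ 0) : μ t * μ t⁻¹ = 1 := by
  rw [mu_mul_mu i₀ hμ, mul_inv_cancel₀ ht, mu_one i₀ hμ]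

/-- `μ(t⁻¹) μ(t) = 1` for `t ≠ 0`. [cite: Kottwitz1992, §4 Lemma 4.1 (2)] -/
theorem mu_inv_mul_mu {μ : ℂ → Matrix m m ℂ} (hμ : ∀ t, μ t = Matrix.diagonal fun i => if i = i₀ then t else 1)
    {t : ℂ} (ht : t ≠ 0) : μ t⁻¹ * μ t = 1 := by
  rw [mu_mul_mu i₀ hμ, inv_mul_cancel₀ ht, mu_one i₀ hμ]

/-- **The adjoint action of `μ(t)` in coordinates**: `(μ(t) X μ(t⁻¹))ᵢⱼ = dᵢ Xᵢⱼ dⱼ⁻¹` with `d = (t at i₀, 1 elsewhere)`.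
[cite: Kottwitz1992, §4 Lemma 4.1 (2)] -/
theorem mu_conj_apply {μ : ℂ → Matrix m m ℂ} (hμ : ∀ t, μ t = Matrix.diagonal fun i => if i = i₀ then t else 1)
    (t : ℂ) (X : Matrix m m ℂ) (i j : m) :
    (μ t * X * μ t⁻¹) i j = (if i = i₀ then t else 1) * X i j * (if j = i₀ then t⁻¹ else 1) := by
  rw [hμ, hμ, Matrix.mul_diagonal, Matrix.diagonal_mul]

/-! ## §2 The weights of `Ad ∘ μ_h` on `𝔤𝔩_n(ℂ)` are `1, 0, −1` -/

/-- **Weight `1`**: a matrix supported on the row `i₀` off the diagonal (`Xᵢⱼ = 0` unless `i = i₀ ≠ j` — the block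
`Hom(V⁻, V⁺)`) satisfies `μ(t) X μ(t)⁻¹ = t · X`. [cite: Kottwitz1992, §4 Lemma 4.1 (2)] -/
theorem mu_conj_eq_smul_of_row {μ : ℂ → Matrix m m ℂ} (hμ : ∀ t, μ t = Matrix.diagonal fun i => if i = i₀ then t else 1)
    (t : ℂ) {X : Matrix m m ℂ} (hX : ∀ i j, X i j ≠ 0 → i = i₀ ∧ j ≠ i₀) :
    μ t * X * μ t⁻¹ = t • X := by
  ext i j
  rw [mu_conj_apply i₀ hμ, Matrix.smul_apply, smul_eq_mul]
  by_cases h0 : X i j = 0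
  · rw [h0, mul_zero, zero_mul, mul_zero]
  · obtain ⟨hi, hj⟩ := hX i j h0
    rw [if_pos hi, if_neg hj, mul_one]

/-- **Weight `−1`**: a matrix supported on the column `i₀` off the diagonal (the block `Hom(V⁺, V⁻)`) satisfies
`μ(t) X μ(t)⁻¹ = t⁻¹ · X`. [cite: Kottwitz1992, §4 Lemma 4.1 (2)] -/
theorem mu_conj_eq_inv_smul_of_col {μ : ℂ → Matrix m m ℂ}
    (hμ : ∀ t, μ t = Matrix.diagonal fun i => if i = i₀ then t else 1) (t : ℂ) {X : Matrix m m ℂ}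
    (hX : ∀ i j, X i j ≠ 0 → i ≠ i₀ ∧ j = i₀) : μ t * X * μ t⁻¹ = t⁻¹ • X := by
  ext i j
  rw [mu_conj_apply i₀ hμ, Matrix.smul_apply, smul_eq_mul]
  by_cases h0 : X i j = 0
  · rw [h0, mul_zero, zero_mul, mul_zero]
  · obtain ⟨hi, hj⟩ := hX i j h0
    rw [if_neg hi, if_pos hj, one_mul, mul_comm]

/-- **Weight `0`**: a block-diagonal matrix (`Xᵢ₀ⱼ = 0 = Xⱼᵢ₀` for `j ≠ i₀` — `End(V⁺) × End(V⁻)`) commutes with `μ(t)`: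
`μ(t) X μ(t)⁻¹ = X`. [cite: Kottwitz1992, §4 Lemma 4.1 (2)] -/
theorem mu_conj_eq_self_of_block {μ : ℂ → Matrix m m ℂ}
    (hμ : ∀ t, μ t = Matrix.diagonal fun i => if i = i₀ then t else 1) {t : ℂ} (ht : t ≠ 0) {X : Matrix m m ℂ}
    (hX : ∀ j, j ≠ i₀ → X i₀ j = 0 ∧ X j i₀ = 0) : μ t * X * μ t⁻¹ = X := by
  ext i j
  rw [mu_conj_apply i₀ hμ]
  by_cases hi : i = i₀ <;> by_cases hj : j = i₀
  · rw [if_pos hi, if_pos hj, mul_assoc, mul_comm (X i j), ← mul_assoc, mul_inv_cancel₀ ht, one_mul]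
  · rw [hi, (hX j hj).1, mul_zero, zero_mul]
  · rw [hj, (hX i hi).2, mul_zero, zero_mul]
  · rw [if_neg hi, if_neg hj, one_mul, mul_one]

omit [Fintype m] in
/-- **Every `X ∈ 𝔤𝔩_n(ℂ)` decomposes as `X = X₁ + X₀ + X₋₁`** into a row-`i₀` piece (weight `1`), a block-diagonal piece
(weight `0`) and a column-`i₀` piece (weight `−1`): with §2's three identities, «`𝔾_m`, acting on the Lie algebra of
`GL_ℂ(V_ℂ)` by means of `μ_h` and the adjoint action, has weights `1, 0, −1`» — Deligne's (2.1.1.1) for `GL_n ⊇ GU(W_{φ₀})`.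
[cite: Kottwitz1992, §4 Lemma 4.1 (2)] -/
theorem exists_weight_decomposition (X : Matrix m m ℂ) :
    ∃ Xp Xz Xm : Matrix m m ℂ, X = Xp + Xz + Xm ∧ (∀ i j, Xp i j ≠ 0 → i = i₀ ∧ j ≠ i₀) ∧
      (∀ j, j ≠ i₀ → Xz i₀ j = 0 ∧ Xz j i₀ = 0) ∧ ∀ i j, Xm i j ≠ 0 → i ≠ i₀ ∧ j = i₀ := by
  refine ⟨Matrix.of fun i j => if i = i₀ ∧ j ≠ i₀ then X i j else 0,
    Matrix.of fun i j => if (i = i₀ ↔ j = i₀) then X i j else 0,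
    Matrix.of fun i j => if i ≠ i₀ ∧ j = i₀ then X i j else 0, ?_, ?_, ?_, ?_⟩
  · ext i j
    simp only [Matrix.add_apply, Matrix.of_apply]
    by_cases hi : i = i₀ <;> by_cases hj : j = i₀ <;> simp [hi, hj]
  · intro i j h
    simp only [Matrix.of_apply, ne_eq, ite_eq_right_iff, Classical.not_imp] at h
    exact h.1
  · intro j hj
    simp only [Matrix.of_apply]
    constructor <;> simp [hj]
  · intro i j h
    simp only [Matrix.of_apply, ne_eq, ite_eq_right_iff, Classical.not_imp] at h
    exact h.1

/-- Conversely the three weight identities determine the weight: on a weight-`1` piece `Ad μ(t)` is NOT trivial for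
`t ≠ 1` unless the piece vanishes (so the weight `1` genuinely occurs as soon as `n ≥ 2`: e.g. `X = E_{i₀ j}`).
[cite: Kottwitz1992, §4 Lemma 4.1 (2)] -/
theorem mu_conj_ne_self_of_row {μ : ℂ → Matrix m m ℂ} (hμ : ∀ t, μ t = Matrix.diagonal fun i => if i = i₀ then t else 1)
    {t : ℂ} (ht1 : t ≠ 1) {X : Matrix m m ℂ} (hX : ∀ i j, X i j ≠ 0 → i = i₀ ∧ j ≠ i₀) (hX0 : X ≠ 0) :
    μ t * X * μ t⁻¹ ≠ X := by
  rw [mu_conj_eq_smul_of_row i₀ hμ t hX]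
  intro h
  apply hX0
  have h' : (t - 1) • X = 0 := by rw [sub_smul, one_smul, h, sub_self]
  exact (smul_eq_zero.1 h').resolve_left (sub_ne_zero.2 ht1)

/-! ## §3 `Int(h(√−1)) = Int(J_{φ₀})`; its fixed points are the block-diagonal matrices -/

omit [Fintype m] in
/-- `h(√−1) = √−1 · J_{φ₀}` (`diag(√−1, −√−1, …, −√−1)`). [cite: RapoportSmithlingZhang2017, §3.1] -/
theorem h_I_eq_I_smul_J {h : ℂ → Matrix m m ℂ} (hh : ∀ z, h z = Matrix.diagonal fun i => if i = i₀ then z else conj z)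
    {J : Matrix m m ℂ} (hJ : J = Matrix.diagonal fun i => if i = i₀ then (1 : ℂ) else -1) : h I = I • J := by
  rw [hh, hJ, ← Matrix.diagonal_smul]
  congr 1; funext i
  simp only [Pi.smul_apply, smul_eq_mul]
  split_ifs <;> simp [Complex.conj_I]

/-- `J_{φ₀}² = 1`. [cite: RapoportSmithlingZhang2017, §3.1] -/
theorem J_mul_J {J : Matrix m m ℂ} (hJ : J = Matrix.diagonal fun i => if i = i₀ then (1 : ℂ) else -1) : J * J = 1 := by
  rw [hJ, Matrix.diagonal_mul_diagonal, ← Matrix.diagonal_one]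
  congr 1; funext i
  split_ifs <;> norm_num

/-- **`Int(h(√−1)) = Int(J)`**: `h(√−1) X h(√−1)⁻¹ = J X J` — the scalar `√−1` is central (Kottwitz 4.1 (1): «the image
under `h` of `ℝ^×` is central», here of all of `ℂ^× · 1`), and `J⁻¹ = J`.  [cite: Kottwitz1992, §4 Lemma 4.1 (3)] -/
theorem h_I_conj_eq_J_conj {h : ℂ → Matrix m m ℂ} (hh : ∀ z, h z = Matrix.diagonal fun i => if i = i₀ then z else conj z)
    {J : Matrix m m ℂ} (hJ : J = Matrix.diagonal fun i => if i = i₀ then (1 : ℂ) else -1) (X : Matrix m m ℂ) :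
    h I * X * (h I)⁻¹ = J * X * J := by
  have hJJ := J_mul_J i₀ hJ
  have hI : h I = I • J := h_I_eq_I_smul_J i₀ hh hJ
  have hinv : (h I)⁻¹ = (-I) • J := by
    refine Matrix.inv_eq_left_inv ?_
    rw [hI, Matrix.smul_mul, Matrix.mul_smul, smul_smul, hJJ, neg_mul, I_mul_I, neg_neg, one_smul]
  rw [hinv, hI, Matrix.smul_mul, Matrix.smul_mul, Matrix.mul_smul, smul_smul, mul_neg, I_mul_I, neg_neg, one_smul]

/-- **The fixed points of `Int(J_{φ₀})` on `M_n(ℂ)` — equivalently the centraliser of `h(√−1)` — are the block-diagonal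
matrices**: `J X J = X ⟺ Xᵢ₀ⱼ = 0 = Xⱼᵢ₀` for all `j ≠ i₀` (the weight-`0` space of §2; its intersection with `U(J)(ℝ)`
is `K_∞`, §4). [cite: Kottwitz1992, §4 Lemma 4.1 (3)] [cite: RapoportSmithlingZhang2017, Remark 3.2] -/
theorem J_conj_eq_self_iff {J : Matrix m m ℂ} (hJ : J = Matrix.diagonal fun i => if i = i₀ then (1 : ℂ) else -1)
    (X : Matrix m m ℂ) : J * X * J = X ↔ ∀ j, j ≠ i₀ → X i₀ j = 0 ∧ X j i₀ = 0 := by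
  have happ : ∀ i j, (J * X * J) i j = (if i = i₀ then (1 : ℂ) else -1) * X i j * (if j = i₀ then (1 : ℂ) else -1) := by
    intro i j
    rw [hJ, Matrix.mul_diagonal, Matrix.diagonal_mul]
  constructor
  · intro h j hj
    have h1 := congrFun (congrFun h i₀) j
    have h2 := congrFun (congrFun h j) i₀
    rw [happ, if_pos rfl, if_neg hj, one_mul, mul_neg_one, neg_eq_iff_add_eq_zero, ← two_mul] at h1
    rw [happ, if_neg hj, if_pos rfl, mul_one, neg_one_mul, neg_eq_iff_add_eq_zero, ← two_mul] at h2
    exact ⟨(mul_eq_zero.1 h1).resolve_left two_ne_zero, (mul_eq_zero.1 h2).resolve_left two_ne_zero⟩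
  · intro h
    ext i j
    rw [happ]
    by_cases hi : i = i₀ <;> by_cases hj : j = i₀
    · rw [if_pos hi, if_pos hj, one_mul, mul_one]
    · subst hi; rw [(h j hj).1, mul_zero, zero_mul]
    · subst hj; rw [(h i hi).2, mul_zero, zero_mul]
    · rw [if_neg hi, if_neg hj, neg_one_mul, mul_neg_one, neg_neg]

/-! ## §4 `K_∞ = U(1) × U(n−1)`, the centraliser of `h(√−1)` in `U(W_{φ₀})(ℝ)`, is compact -/

/-- `(ᵗḡ J g)ᵢⱼ = Σ_l conj(g_li) J_ll g_lj` for diagonal `J`. [folklore] -/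
private theorem conjTranspose_mul_diagonal_mul_apply (s : m → ℂ) (g : Matrix m m ℂ) (i j : m) :
    ((g.map (starRingEnd ℂ))ᵀ * Matrix.diagonal s * g) i j = ∑ l, conj (g l i) * s l * g l j := by
  rw [Matrix.mul_apply]
  refine Finset.sum_congr rfl fun l _ => ?_
  rw [Matrix.mul_diagonal, Matrix.transpose_apply, Matrix.map_apply]

/-- **`K_∞ = U(1) × U(n−1)`**: a matrix `g` with `ᵗḡ J_{φ₀} g = J_{φ₀}` (unitary for `W_{φ₀}`) commuting with `J_{φ₀}`
(equivalently with `h(√−1)`, §3) is exactly a block-diagonal matrix whose `i₀`-entry has `|g_{i₀i₀}|² = 1` and whose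
complementary block `B = (g_lj)_{l, j ≠ i₀}` is unitary, `Σ_{l ≠ i₀} conj(g_li) g_lj = δᵢⱼ` — Kottwitz's
«`{x : x x* = 1, h(i)⁻¹ x h(i) = x}`» for this datum. [cite: Kottwitz1992, §4 Lemma 4.1 (3)] [cite: RapoportSmithlingZhang2017, Remark 3.2] -/
theorem kInfty_iff {J : Matrix m m ℂ} (hJ : J = Matrix.diagonal fun i => if i = i₀ then (1 : ℂ) else -1)
    (g : Matrix m m ℂ) :
    ((g.map (starRingEnd ℂ))ᵀ * J * g = J ∧ J * g * J = g) ↔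
      ((∀ j, j ≠ i₀ → g i₀ j = 0 ∧ g j i₀ = 0) ∧ conj (g i₀ i₀) * g i₀ i₀ = 1 ∧
        ∀ i j, i ≠ i₀ → j ≠ i₀ → ∑ l ∈ Finset.univ.erase i₀, conj (g l i) * g l j = if i = j then 1 else 0) := by
  rw [J_conj_eq_self_iff i₀ hJ]
  have happ : ∀ i j, ((g.map (starRingEnd ℂ))ᵀ * J * g) i j =
      ∑ l, conj (g l i) * (if l = i₀ then (1 : ℂ) else -1) * g l j := fun i j => by
    rw [hJ]; exact conjTranspose_mul_diagonal_mul_apply _ g i j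
  constructor
  · rintro ⟨hU, hblock⟩
    refine ⟨hblock, ?_, fun i j hi hj => ?_⟩
    · have h := congrFun (congrFun hU i₀) i₀
      rw [happ, ← Finset.add_sum_erase _ _ (Finset.mem_univ i₀), if_pos rfl, mul_one,
        Finset.sum_eq_zero (fun l hl => by rw [(hblock l (Finset.ne_of_mem_erase hl)).2, mul_zero]), add_zero, hJ,
        Matrix.diagonal_apply_eq, if_pos rfl] at h
      exact h
    · have h := congrFun (congrFun hU i) j
      rw [happ, ← Finset.add_sum_erase _ _ (Finset.mem_univ i₀), (hblock i hi).1, map_zero, zero_mul, zero_mul,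
        zero_add, hJ, Matrix.diagonal_apply] at h
      have hs : ∑ l ∈ Finset.univ.erase i₀, conj (g l i) * (if l = i₀ then (1 : ℂ) else -1) * g l j =
          -∑ l ∈ Finset.univ.erase i₀, conj (g l i) * g l j := by
        rw [← Finset.sum_neg_distrib]
        exact Finset.sum_congr rfl fun l hl => by rw [if_neg (Finset.ne_of_mem_erase hl), mul_neg_one, neg_mul]
      rw [hs, if_neg hi] at h
      rw [← neg_neg (∑ l ∈ Finset.univ.erase i₀, conj (g l i) * g l j), h]
      split_ifs <;> simp
  · rintro ⟨hblock, h00, hB⟩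
    refine ⟨?_, hblock⟩
    ext i j
    rw [happ, hJ, Matrix.diagonal_apply, ← Finset.add_sum_erase _ _ (Finset.mem_univ i₀), if_pos rfl, mul_one]
    by_cases hi : i = i₀ <;> by_cases hj : j = i₀
    · subst hi; subst hj
      rw [h00, Finset.sum_eq_zero (fun l hl => by rw [(hblock l (Finset.ne_of_mem_erase hl)).2, mul_zero]), add_zero,
        if_pos rfl, if_pos rfl]
    · subst hi
      rw [(hblock j hj).1, mul_zero, zero_add, if_neg (Ne.symm hj),
        Finset.sum_eq_zero (fun l hl => by rw [(hblock l (Finset.ne_of_mem_erase hl)).2, map_zero, zero_mul, zero_mul])]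
    · subst hj
      rw [(hblock i hi).1, map_zero, zero_mul, zero_add, if_neg hi,
        Finset.sum_eq_zero (fun l hl => by rw [(hblock l (Finset.ne_of_mem_erase hl)).2, mul_zero])]
    · rw [(hblock i hi).1, map_zero, zero_mul, zero_add, if_neg hi]
      have hs : ∑ l ∈ Finset.univ.erase i₀, conj (g l i) * (if l = i₀ then (1 : ℂ) else -1) * g l j =
          -∑ l ∈ Finset.univ.erase i₀, conj (g l i) * g l j := by
        rw [← Finset.sum_neg_distrib]
        exact Finset.sum_congr rfl fun l hl => by rw [if_neg (Finset.ne_of_mem_erase hl), mul_neg_one, neg_mul]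
      rw [hs, hB i j hi hj]
      split_ifs <;> simp

omit [DecidableEq m] in
/-- `Σ_l |g_lj|² = 1` forces `|g_ij|² ≤ 1`. [folklore] -/
private theorem normSq_le_of_sum_eq_one {g : Matrix m m ℂ} {j : m} (h : ∑ l, conj (g l j) * g l j = 1) (i : m) :
    Complex.normSq (g i j) ≤ 1 := by
  have hsum : ∑ l, Complex.normSq (g l j) = 1 := by
    have h' := congrArg Complex.re h
    rw [Complex.re_sum, Complex.one_re] at h'
    rw [← h']
    exact Finset.sum_congr rfl fun l _ => by rw [← Complex.normSq_eq_conj_mul_self, Complex.ofReal_re]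
  rw [← hsum]
  exact Finset.single_le_sum (fun l _ => Complex.normSq_nonneg (g l j)) (Finset.mem_univ i)

/-- **`K_∞` is bounded**: every entry of a unitary `g` commuting with `J_{φ₀}` has `|gᵢⱼ|² ≤ 1` (each column of the two
unitary blocks has hermitian length `1`). [cite: Kottwitz1992, §4 Lemma 4.1 (3)] -/
theorem normSq_apply_le_one_of_kInfty {J : Matrix m m ℂ}
    (hJ : J = Matrix.diagonal fun i => if i = i₀ then (1 : ℂ) else -1) {g : Matrix m m ℂ}
    (hU : (g.map (starRingEnd ℂ))ᵀ * J * g = J) (hc : J * g * J = g) (i j : m) : Complex.normSq (g i j) ≤ 1 := by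
  obtain ⟨hblock, h00, hB⟩ := (kInfty_iff i₀ hJ g).1 ⟨hU, hc⟩
  -- every column has hermitian length one once the vanishing entries are put back
  have hcol : ∀ j, ∑ l, conj (g l j) * g l j = 1 := by
    intro j
    rw [← Finset.add_sum_erase _ _ (Finset.mem_univ i₀)]
    by_cases hj : j = i₀
    · subst hj
      rw [h00, Finset.sum_eq_zero (fun l hl => by rw [(hblock l (Finset.ne_of_mem_erase hl)).2, mul_zero]), add_zero]
    · rw [(hblock j hj).1, map_zero, zero_mul, zero_add, hB j j hj hj, if_pos rfl]
  exact normSq_le_of_sum_eq_one (hcol j) i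

/-- **`K_∞` is COMPACT** (Kottwitz 4.1 (3) for the datum `(GU(W_{φ₀}), h_{G^ℚ,φ₀})`: «we must show that the group
`{x ∈ C ⊗ ℝ | x x* = 1 and h(i)⁻¹ x h(i) = x}` is compact»): the set of `g ∈ M_n(ℂ)` with `ᵗḡ J g = J` and `J g J = g` is
closed (polynomial equations) and contained in the compact product of closed unit discs.
[cite: Kottwitz1992, §4 Lemma 4.1 (3)] [cite: RapoportSmithlingZhang2017, Remark 3.2] -/
theorem isCompact_kInfty {J : Matrix m m ℂ} (hJ : J = Matrix.diagonal fun i => if i = i₀ then (1 : ℂ) else -1) :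
    IsCompact {g : Matrix m m ℂ | (g.map (starRingEnd ℂ))ᵀ * J * g = J ∧ J * g * J = g} := by
  -- the product of closed unit discs, a compact subset of `M_n(ℂ) = m → m → ℂ`
  have hpi : IsCompact (Set.univ.pi fun (_ : m) => Set.univ.pi fun (_ : m) => Metric.closedBall (0 : ℂ) 1) :=
    isCompact_univ_pi fun _ => isCompact_univ_pi fun _ => ProperSpace.isCompact_closedBall (0 : ℂ) 1
  have hof : Continuous fun f : m → m → ℂ => Matrix.of f :=
    continuous_matrix fun i j => (continuous_apply j).comp (continuous_apply i)
  have hK := hpi.image hof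
  have hcont₁ : Continuous fun g : Matrix m m ℂ => (g.map (starRingEnd ℂ))ᵀ * J * g :=
    ((continuous_id.matrix_map Complex.continuous_conj).matrix_transpose.matrix_mul continuous_const).matrix_mul
      continuous_id
  have hcont₂ : Continuous fun g : Matrix m m ℂ => J * g * J :=
    (continuous_const.matrix_mul continuous_id).matrix_mul continuous_const
  have hclosed : IsClosed {g : Matrix m m ℂ | (g.map (starRingEnd ℂ))ᵀ * J * g = J ∧ J * g * J = g} :=
    (isClosed_eq hcont₁ continuous_const).inter (isClosed_eq hcont₂ continuous_id)
  refine hK.of_isClosed_subset hclosed fun g hg => ⟨fun i j => g i j, ?_, rfl⟩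
  simp only [Set.mem_univ_pi]
  intro i j
  have h1 := normSq_apply_le_one_of_kInfty i₀ hJ hg.1 hg.2 i j
  rw [Complex.normSq_eq_norm_sq] at h1
  rw [Metric.mem_closedBall, dist_zero_right]
  exact (sq_le_one_iff₀ (norm_nonneg _)).1 h1

end Literature.NumberTheory.Automorphic.UnitaryShimuraDatum
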